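import Summits.AtomisticToContinuum.Crystallization.Theorems.FrustratedLawDichotomyCoherentFloorAlgebra

/-!
# FrustratedLawDichotomy · crux `AperiodicFrustratedLawGap` (stmt-AtomisticToContinuum-27623) — DROWS-SOUND piece (s2): THE EXACT SHELL MINIMUM
# (decomp-a2c, RESIDUAL lens-5, generation 112; critic r1757 (C) «DROWS-SOUND» (s1)–(s5), registered on the lens-5 docket r1759)

The class-D rows (census D-ROWS: A15 / C15 / bcc, certified in K as data-free kernel computations) book, shell by shell, the EXACT minimum of the pair
potential over the shell's squared-distance window `[lo, hi]`.  In the variable `t = r²` the Lennard-Jones potential is `phiT t = t⁻⁶/12 − t⁻³/6 =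
((t⁻³ − 1)² − 1)/12` ((225) `…CoherentFloorAlgebra.phiT`; `lennardJones r = phiT (r²)` is (226) `…CoherentFloor.lennardJones_eq_phiT`): it is ANTITONE on
`(0, 1]`, MONOTONE on `[1, ∞)`, with global minimum `−1/12` at `t = 1`.  Hence the soundness half of (s2), calculus-free:

* `phiT_eq_sq`, `phiT_one`, `neg_twelfth_le_phiT`, `phiT_sub_phiT` (the factorisation `φ(t) − φ(s) = (u_t − u_s)(u_t + u_s − 2)/12`, `u = t⁻³`);
* `phiT_le_phiT_of_le_one` (antitone left of 1), `phiT_le_phiT_of_one_le` (monotone right of 1);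
* `shellMin lo hi` — the closed-form window minimum (`phiT hi` if `hi ≤ 1`, `phiT lo` if `1 ≤ lo`, else `−1/12`) and ★ `shellMin_le_phiT :
  0 < lo → lo ≤ t → t ≤ hi → shellMin lo hi ≤ phiT t`; `shellMin_attained` (the bound is a value of `phiT` on the window or the global minimum inside it —
  i.e. exact, no slack).

The K files evaluate `shellMin` on rational windows with outward rounding ((s4), their own arithmetic); (s3) is TREE `…FarFieldSharp.sum_inv_pow_le_of_separated_sharp`;
(s5) is TREE `…PeriodicEnergyCeilingKernel.eStar_le : eStar ≤ −7175/10000` with `eStar` = `…ChargedEnergyGapNegative.eStar`.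
DEFS `shellMin` (plain `def`); imports (225) `…CoherentFloorAlgebra` only; 0 sorry.  Tags: [folklore].
-/

noncomputable section

namespace Summit.AtomisticToContinuum.Crystallization.Theorems.FrustratedLawDichotomyShellMinimum

open Summit.AtomisticToContinuum.Crystallization.Theorems.FrustratedLawDichotomyCoherentFloorAlgebra (phiT)

/-- `φ(t) = ((t⁻³ − 1)² − 1)/12`. [folklore] -/
theorem phiT_eq_sq (t : ℝ) : phiT t = 1 / 12 * (t⁻¹ ^ 3 - 1) ^ 2 - 1 / 12 := by
  unfold phiT; ring

/-- `φ(1) = −1/12` (the well depth in the `t = r²` variable; `σ = 1`, `ε = 1/12·…` normalisation of the tree's `lennardJones`). [folklore] -/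
theorem phiT_one : phiT 1 = -(1 / 12) := by
  unfold phiT; norm_num

/-- The global floor `−1/12 ≤ φ(t)` (all real `t`; junk value at `t = 0` included). [folklore] -/
theorem neg_twelfth_le_phiT (t : ℝ) : -(1 / 12) ≤ phiT t := by
  rw [phiT_eq_sq]; nlinarith [sq_nonneg (t⁻¹ ^ 3 - 1)]

/-- The factorisation `φ(t) − φ(s) = (u_t − u_s)(u_t + u_s − 2)/12` with `u = t⁻³`. [folklore] -/
theorem phiT_sub_phiT (s t : ℝ) : phiT t - phiT s = 1 / 12 * (t⁻¹ ^ 3 - s⁻¹ ^ 3) * (t⁻¹ ^ 3 + s⁻¹ ^ 3 - 2) := by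
  unfold phiT; ring

/-- `u = t⁻³` is antitone on `(0, ∞)`. [folklore] -/
theorem inv_pow_three_le {s t : ℝ} (h0 : 0 < s) (hst : s ≤ t) : t⁻¹ ^ 3 ≤ s⁻¹ ^ 3 :=
  pow_le_pow_left₀ (inv_nonneg.2 (h0.trans_le hst).le) (inv_anti₀ h0 hst) 3

/-- `t ≤ 1 ⇒ 1 ≤ t⁻³` for `0 < t`. [folklore] -/
theorem one_le_inv_pow_three {t : ℝ} (h0 : 0 < t) (h1 : t ≤ 1) : 1 ≤ t⁻¹ ^ 3 :=
  one_le_pow₀ ((one_le_inv₀ h0).2 h1)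

/-- `1 ≤ t ⇒ t⁻³ ≤ 1`. [folklore] -/
theorem inv_pow_three_le_one {t : ℝ} (h1 : 1 ≤ t) : t⁻¹ ^ 3 ≤ 1 :=
  pow_le_one₀ (inv_nonneg.2 (zero_le_one.trans h1)) ((inv_le_one₀ (zero_lt_one.trans_le h1)).2 h1)

/-- ★ `φ` is ANTITONE on `(0, 1]`: `0 < s ≤ t ≤ 1 ⇒ φ(t) ≤ φ(s)`. [folklore] -/
theorem phiT_le_phiT_of_le_one {s t : ℝ} (h0 : 0 < s) (hst : s ≤ t) (ht1 : t ≤ 1) : phiT t ≤ phiT s := by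
  have h := phiT_sub_phiT s t
  have hA : t⁻¹ ^ 3 - s⁻¹ ^ 3 ≤ 0 := by linarith [inv_pow_three_le h0 hst]
  have hB : 0 ≤ t⁻¹ ^ 3 + s⁻¹ ^ 3 - 2 := by
    linarith [one_le_inv_pow_three (h0.trans_le hst) ht1, one_le_inv_pow_three h0 (hst.trans ht1)]
  nlinarith [mul_nonneg (neg_nonneg.2 hA) hB]

/-- ★ `φ` is MONOTONE on `[1, ∞)`: `1 ≤ s ≤ t ⇒ φ(s) ≤ φ(t)`. [folklore] -/
theorem phiT_le_phiT_of_one_le {s t : ℝ} (h1 : 1 ≤ s) (hst : s ≤ t) : phiT s ≤ phiT t := by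
  have h := phiT_sub_phiT s t
  have hA : t⁻¹ ^ 3 - s⁻¹ ^ 3 ≤ 0 := by linarith [inv_pow_three_le (zero_lt_one.trans_le h1) hst]
  have hB : t⁻¹ ^ 3 + s⁻¹ ^ 3 - 2 ≤ 0 := by
    linarith [inv_pow_three_le_one h1, inv_pow_three_le_one (h1.trans hst)]
  nlinarith [mul_nonneg (neg_nonneg.2 hA) (neg_nonneg.2 hB)]

/-- THE EXACT SHELL MINIMUM of `φ` over the squared-distance window `[lo, hi]` (`0 < lo`): `φ(hi)` left of the well, `φ(lo)` right of it, the well depth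
`−1/12` when `t = 1` lies in the window. [folklore] -/
def shellMin (lo hi : ℝ) : ℝ := if hi ≤ 1 then phiT hi else if 1 ≤ lo then phiT lo else -(1 / 12)

/-- ★★ SOUNDNESS OF THE SHELL MINIMUM: `0 < lo ≤ t ≤ hi ⇒ shellMin lo hi ≤ φ(t)`. [folklore] -/
theorem shellMin_le_phiT {lo hi t : ℝ} (h0 : 0 < lo) (hlo : lo ≤ t) (hhi : t ≤ hi) : shellMin lo hi ≤ phiT t := by
  unfold shellMin
  split_ifs with h1 h2
  · exact phiT_le_phiT_of_le_one (h0.trans_le hlo) hhi h1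
  · exact phiT_le_phiT_of_one_le h2 hlo
  · exact neg_twelfth_le_phiT t

/-- EXACTNESS: the shell minimum is attained on the window (so the D-row bookings carry no slack at this step). [folklore] -/
theorem shellMin_attained {lo hi : ℝ} (hlh : lo ≤ hi) : ∃ t, lo ≤ t ∧ t ≤ hi ∧ phiT t = shellMin lo hi := by
  unfold shellMin
  split_ifs with h1 h2
  · exact ⟨hi, hlh, le_rfl, rfl⟩
  · exact ⟨lo, le_rfl, hlh, rfl⟩
  · exact ⟨1, (not_le.1 h2).le, (not_le.1 h1).le, phiT_one⟩

/-- Window monotonicity: shrinking the window can only raise the shell minimum (used when a K file splits a leaf). [folklore] -/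
theorem shellMin_mono {lo hi lo' hi' : ℝ} (h0 : 0 < lo) (hl : lo ≤ lo') (hh : hi' ≤ hi) (hlh : lo' ≤ hi') : shellMin lo hi ≤ shellMin lo' hi' := by
  obtain ⟨t, ht1, ht2, ht⟩ := shellMin_attained hlh
  rw [← ht]
  exact shellMin_le_phiT h0 (hl.trans ht1) (ht2.trans hh)

end Summit.AtomisticToContinuum.Crystallization.Theorems.FrustratedLawDichotomyShellMinimum

end
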